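import Summits.AtomisticToContinuum.FouriersLaw.Theorems.HonestZwanzigRobinCoercivityFluxReduction
import Summits.AtomisticToContinuum.FouriersLaw.Theorems.HonestZwanzigRobinCoercivityStubFluxBoundPointwise

/-!
# `HonestZwanzig.RobinCoercivity` holds POINTWISE in `N` (line LinAlg)

Support file for the crux `stmt-AtomisticToContinuum-12695` (`RobinCoercivity` of route `HonestZwanzig`, sub-problem
`FouriersLaw`). The crux asks for a constant `c > 0` that works for ALL `N ≥ 2`. Here we prove, sorry-free, the statement
with the quantifiers exchanged — for every `N ≥ 2` there is `c = c(N) > 0` — and in fact for EVERY `s > 0` (no `s₀`):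
the fixed-`N` flux bound `stub_fluxBoundPointwise` (CEHR exponential mixing gives `Σ_{x,y}∫|corr(e_x,e_y)| < ∞`, and
`Cov(e,e)` is positive definite) fed into the fixed-`(N,s)` reduction `robin_fixedN`. So the ONLY open content of the
crux is the UNIFORMITY of `c` in `N`, i.e. the N-uniform flux bound `stub_fluxBound`.

* `robinCoercivity_eachN` — abstract-gadget form at fixed `N` (all `s > 0`).
* `robinCoercivity_pointwise` — the route decl's own `let`-chain with `∀ N, ∃ c` and `∀ s > 0`.
-/

noncomputable section

open MeasureTheory Finset Matrix
open Literature.MathematicalPhysics.KineticTheory.HeatConduction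
open Summit.AtomisticToContinuum.FouriersLaw.Theses.HonestZwanzig
open Summit.AtomisticToContinuum.FouriersLaw.Theorems.HonestZwanzig.NetworkReduction

namespace Summit.AtomisticToContinuum.FouriersLaw.Theorems.HonestZwanzig.Robin

/-- **Robin coercivity at each fixed `N`, for every `s > 0`** (abstract gadgets `lap, cov, e, G, schur, F` with their
defining equations): there is `c = c(N) > 0` with `c·(Σ_b (ξ_{b+1} − ξ_b)² + ξ_0² + ξ_{N−1}²) ≤ ξᵀ𝔽_N(s)ξ` for all `s > 0`
and all profiles `ξ`. -/
theorem robinCoercivity_eachN {ω₂ lam β γ : ℝ} {N : ℕ} {T : ℝ} (hω : 0 < ω₂) (hl : 0 < lam) (hβ : 0 < β)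
    (hγ : 0 < γ) (hT : 0 < T) (hN : 2 ≤ N)
    (lap : ℝ → (PhaseSpace N → ℝ) → (PhaseSpace N → ℝ) → ℝ)
    (cov : (PhaseSpace N → ℝ) → (PhaseSpace N → ℝ) → ℝ) (e : Fin N → PhaseSpace N → ℝ)
    (G : ℝ → Matrix (Fin N) (Fin N) ℝ) (schur : ℝ → (PhaseSpace N → ℝ) → (PhaseSpace N → ℝ) → ℝ)
    (F : ℝ → Fin N → Fin N → ℝ)
    (hlap : ∀ s f g, lap s f g = ∫ t in Set.Ioi (0 : ℝ), Real.exp (-(s * t)) *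
      ((∫ z, f z * (∫ y, g y ∂((pinnedChain ω₂ lam β γ).transitionKernel N T T t.toNNReal z))
          ∂(pinnedChain ω₂ lam β γ).gibbsMeasure N T) -
        (∫ z, f z ∂(pinnedChain ω₂ lam β γ).gibbsMeasure N T) *
          (∫ z, g z ∂(pinnedChain ω₂ lam β γ).gibbsMeasure N T)))
    (hcov : ∀ f g, cov f g = (∫ z, f z * g z ∂(pinnedChain ω₂ lam β γ).gibbsMeasure N T) -
      (∫ z, f z ∂(pinnedChain ω₂ lam β γ).gibbsMeasure N T) *
        (∫ z, g z ∂(pinnedChain ω₂ lam β γ).gibbsMeasure N T))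
    (he : ∀ x z, e x z = z.2 x ^ 2 / 2 + (pinnedChain ω₂ lam β γ).U (z.1 x) +
      ∑ j : Fin N, ((if j.val = x.val + 1 then (pinnedChain ω₂ lam β γ).V (z.1 j - z.1 x) / 2 else 0) +
        (if x.val = j.val + 1 then (pinnedChain ω₂ lam β γ).V (z.1 x - z.1 j) / 2 else 0)))
    (hG : ∀ s, G s = Matrix.of fun x y => lap s (e x) (e y))
    (hschur : ∀ s f g, schur s f g = lap s f g - ∑ x, ∑ y, lap s f (e x) * (G s)⁻¹ x y * lap s (e y) g)
    (hF : ∀ s x y, F s x y = s * cov (e x) (e y) - cov (e x) ((pinnedChain ω₂ lam β γ).generator N T T (e y)) -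
      schur s (fun z => (pinnedChain ω₂ lam β γ).generator N T T (e x) (z.1, -z.2))
        ((pinnedChain ω₂ lam β γ).generator N T T (e y))) :
    ∃ c : ℝ, 0 < c ∧ ∀ s : ℝ, 0 < s → ∀ ξ : Fin N → ℝ,
      c * (∑ i : Fin N, ((∑ j : Fin N, if j.val = i.val + 1 then (ξ j - ξ i) ^ 2 else 0) +
        (if i.val = 0 then ξ i ^ 2 else 0) + (if i.val = N - 1 then ξ i ^ 2 else 0))) ≤
      ∑ x, ∑ y, ξ x * F s x y * ξ y := by
  obtain ⟨K, hK, hflux⟩ := stub_fluxBoundPointwise hω hl hβ hγ hT hN lap cov e hlap hcov he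
  refine ⟨K⁻¹, inv_pos.2 hK, fun s hs ξ => ?_⟩
  obtain rfl : lap = fun s f g => ∫ t in Set.Ioi (0 : ℝ), Real.exp (-(s * t)) *
      ((∫ z, f z * (∫ y, g y ∂((pinnedChain ω₂ lam β γ).transitionKernel N T T t.toNNReal z))
          ∂(pinnedChain ω₂ lam β γ).gibbsMeasure N T) -
        (∫ z, f z ∂(pinnedChain ω₂ lam β γ).gibbsMeasure N T) *
          (∫ z, g z ∂(pinnedChain ω₂ lam β γ).gibbsMeasure N T)) :=
    funext fun s => funext fun f => funext fun g => hlap s f g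
  obtain rfl : cov = fun f g => (∫ z, f z * g z ∂(pinnedChain ω₂ lam β γ).gibbsMeasure N T) -
      (∫ z, f z ∂(pinnedChain ω₂ lam β γ).gibbsMeasure N T) *
        (∫ z, g z ∂(pinnedChain ω₂ lam β γ).gibbsMeasure N T) := funext fun f => funext fun g => hcov f g
  obtain rfl : e = fun x z => z.2 x ^ 2 / 2 + (pinnedChain ω₂ lam β γ).U (z.1 x) +
      ∑ j : Fin N, ((if j.val = x.val + 1 then (pinnedChain ω₂ lam β γ).V (z.1 j - z.1 x) / 2 else 0) +
        (if x.val = j.val + 1 then (pinnedChain ω₂ lam β γ).V (z.1 x - z.1 j) / 2 else 0)) :=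
    funext fun x => funext fun z => he x z
  obtain ⟨-, hFI2, hCp, hGp⟩ := stub_feshbachIdentities ω₂ lam β γ hω hl hβ hγ T hT N hN
  have hGs : ∀ x y, G s x y = (fun s f g => ∫ t in Set.Ioi (0 : ℝ), Real.exp (-(s * t)) *
      ((∫ z, f z * (∫ y, g y ∂((pinnedChain ω₂ lam β γ).transitionKernel N T T t.toNNReal z))
          ∂(pinnedChain ω₂ lam β γ).gibbsMeasure N T) -
        (∫ z, f z ∂(pinnedChain ω₂ lam β γ).gibbsMeasure N T) *
          (∫ z, g z ∂(pinnedChain ω₂ lam β γ).gibbsMeasure N T))) s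
      ((fun x z => z.2 x ^ 2 / 2 + (pinnedChain ω₂ lam β γ).U (z.1 x) +
      ∑ j : Fin N, ((if j.val = x.val + 1 then (pinnedChain ω₂ lam β γ).V (z.1 j - z.1 x) / 2 else 0) +
        (if x.val = j.val + 1 then (pinnedChain ω₂ lam β γ).V (z.1 x - z.1 j) / 2 else 0))) x)
      ((fun x z => z.2 x ^ 2 / 2 + (pinnedChain ω₂ lam β γ).U (z.1 x) +
      ∑ j : Fin N, ((if j.val = x.val + 1 then (pinnedChain ω₂ lam β γ).V (z.1 j - z.1 x) / 2 else 0) +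
        (if x.val = j.val + 1 then (pinnedChain ω₂ lam β γ).V (z.1 x - z.1 j) / 2 else 0))) y) := by
    intro x y; rw [hG]; rfl
  have hGp' : ∀ v : Fin N → ℝ, v ≠ 0 → 0 < ∑ x, ∑ y, v x * G s x y * v y := by
    intro v hv
    have h := hGp s hs v hv
    simp only [Matrix.of_apply] at h
    simp only [hG, Matrix.of_apply]
    exact h
  exact robin_fixedN (ω₂ := ω₂) (lam := lam) (β := β) (γ := γ) (N := N) (T := T)
    (corr := fun f g t => (∫ z, f z * (∫ y, g y ∂((pinnedChain ω₂ lam β γ).transitionKernel N T T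
      t.toNNReal z)) ∂(pinnedChain ω₂ lam β γ).gibbsMeasure N T) -
      (∫ z, f z ∂(pinnedChain ω₂ lam β γ).gibbsMeasure N T) * (∫ z, g z ∂(pinnedChain ω₂ lam β γ).gibbsMeasure N T))
    (fun f => Iff.rfl) (fun s f g => rfl) (fun f g => rfl) (fun x z => rfl)
    hFI2 (fun x z => generatorSiteEnergy_proof ω₂ lam β γ N hN T T x z)
    (fun x y => ((parityStatics_proof ω₂ lam β γ hω hl hβ hγ T hT N hN) x).2 y)
    hω hl.le hβ.le hT hN hs (G s) hGs (schur s) (fun f g => hschur s f g) (F s) (fun x y => hF s x y)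
    hGp' hCp hK (hflux s hs) ξ

/-- **`RobinCoercivity` pointwise in `N`.** The route decl `RobinCoercivity` with `∃ c` AFTER `∀ N` (and for every
`s > 0`): for `pinnedChain ω₂ lam β γ` (all `> 0`), `T > 0` and each `N ≥ 2` there is `c = c(N) > 0` such that the
Feshbach matrix dominates `c ×` the Robin form at every `s > 0`. The crux is exactly the uniformity of this `c` in `N`. -/
theorem robinCoercivity_pointwise :
    ∀ ω₂ lam β γ : ℝ, 0 < ω₂ → 0 < lam → 0 < β → 0 < γ → ∀ T : ℝ, 0 < T → ∀ N : ℕ, 2 ≤ N → ∃ c : ℝ, 0 < c ∧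
    let P := Literature.MathematicalPhysics.KineticTheory.HeatConduction.pinnedChain ω₂ lam β γ
    let X := Literature.MathematicalPhysics.KineticTheory.HeatConduction.PhaseSpace N
    let μ : MeasureTheory.Measure X := P.gibbsMeasure N T
    let corr : (X → ℝ) → (X → ℝ) → ℝ → ℝ := fun f g t =>
      (∫ z, f z * (∫ y, g y ∂(P.transitionKernel N T T t.toNNReal z)) ∂μ) - (∫ z, f z ∂μ) * (∫ z, g z ∂μ)
    let lap : ℝ → (X → ℝ) → (X → ℝ) → ℝ := fun s f g =>
      ∫ t in Set.Ioi (0 : ℝ), Real.exp (-(s * t)) * corr f g t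
    let cov : (X → ℝ) → (X → ℝ) → ℝ := fun f g => (∫ z, f z * g z ∂μ) - (∫ z, f z ∂μ) * (∫ z, g z ∂μ)
    let e : Fin N → X → ℝ := fun x z => z.2 x ^ 2 / 2 + P.U (z.1 x) +
      ∑ j : Fin N, ((if j.val = x.val + 1 then P.V (z.1 j - z.1 x) / 2 else 0) +
        (if x.val = j.val + 1 then P.V (z.1 x - z.1 j) / 2 else 0))
    let G : ℝ → Matrix (Fin N) (Fin N) ℝ := fun s => Matrix.of fun x y => lap s (e x) (e y)
    let schur : ℝ → (X → ℝ) → (X → ℝ) → ℝ := fun s f g =>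
      lap s f g - ∑ x : Fin N, ∑ y : Fin N, lap s f (e x) * (G s)⁻¹ x y * lap s (e y) g
    let F : ℝ → Fin N → Fin N → ℝ := fun s x y =>
      s * cov (e x) (e y) - cov (e x) (P.generator N T T (e y)) -
        schur s (fun z => P.generator N T T (e x) (z.1, -z.2)) (P.generator N T T (e y))
    ∀ s : ℝ, 0 < s → ∀ ξ : Fin N → ℝ,
      c * (∑ i : Fin N, ((∑ j : Fin N, if j.val = i.val + 1 then (ξ j - ξ i) ^ 2 else 0) +
        (if i.val = 0 then ξ i ^ 2 else 0) + (if i.val = N - 1 then ξ i ^ 2 else 0))) ≤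
      ∑ x : Fin N, ∑ y : Fin N, ξ x * F s x y * ξ y := by
  intro ω₂ lam β γ hω hl hβ hγ T hT N hN
  exact robinCoercivity_eachN hω hl hβ hγ hT hN _ _ _ _ _ _ (fun _ _ _ => rfl) (fun _ _ => rfl) (fun _ _ => rfl)
    (fun _ => rfl) (fun _ _ _ => rfl) (fun _ _ _ => rfl)

end Summit.AtomisticToContinuum.FouriersLaw.Theorems.HonestZwanzig.Robin

end
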